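import Mathlib
import Summits.CriticalPhenomena.PercolationContinuityZ3.Theorems.PercNearOneGluingAdditiveGluingGoodStepCornerAux
import HarnessLib

/-! # Crux `PercNearOneGluing.AdditiveGluing` (stmt-CriticalPhenomena-4576), line `subuniform-dead-pocket-maximum` — the CORNER REDUCTION of `stub_goodStep` (siege k4)

Helper file for the crux (skeleton `Cruxes/AdditiveGluing/Lines/subuniform-dead-pocket-maximum.lean`,
stub `stub_goodStep` = the inductive step of "every quadruple is good"); lands with
`--supports stmt-CriticalPhenomena-4576`.  Toolkit: `…GoodStepCornerAux.lean`.

Notation (docstrings only): `μ_p = prodBernoulli p`; `w⁰` = `w` with every pair meeting `o` given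
weight `0` (the graph `H = G − o`); for a layer `S` (the open star of `o` is exactly `S`),
`q_S` = `w⁰` with weight `1` on the non-loop pairs inside `S` (`H/S`); `L_S` = the layer event;
`C(o) = openCluster · o`; `E_S(W) = {ω' | ∀ y, y ∈ W ↔ (y = o ∨ ∃ s ∈ S, s ↔ y in ω')}` = the image
of `{C(o) = W}` on `L_S`; the currency of a dead pocket `W ∋ o` under the selection `sel` is
`c_W = μ_w(sel W ↔ b in Wᶜ)`.

**Theorem (`goodStep_corner`) — the corner reduction of the inductive step.**  Let `b ∈ A`, `o ∉ A`,
and let `a₀ ∈ A` minimise `μ_{w⁰}(· ↔ b)` over `A` (the worst relay OFF `o`).  If for every nonempty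
POSITIVE LOW layer `S` (`S ∩ A = ∅`; every `x ∈ S` has `x ≠ o`, `w(o,x) ≠ 0`) the glued corner
inequality  `μ_{q_S}(a₀ ↔ b) ≤ μ_{q_S}(S ↔ b) + Σ_{W ∋ o, W ∩ A = ∅} μ_{q_S}(E_S W) · c_W`  holds, then
`(w, A, o, b)` is GOOD in the skeleton's linear selection form.
Proof (Kozma–Nitzan arXiv:2401.12397 §3.2, proofs of Thms 4–5 pp. 13–14, with the dead pockets
carried along): partition by the layer and factor (toolkit):
`μ_w(a₀↔b) = Σ_S μ(L_S) μ_{q_S}(a₀↔b)`, `μ_w(o↔b) = Σ_S μ(L_S) μ_{q_S}(S↔b)`,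
`μ_w(C(o)=W) = Σ_S μ(L_S) μ_{q_S}(E_S W)`; compare termwise: `S = ∅` (the only pocket is `{o}`, its
currency `μ_w(sel{o} ↔ b in {o}ᶜ) = μ_{w⁰}(sel{o} ↔ b) ≥ μ_{w⁰}(a₀ ↔ b)`), `b ∈ S` (`μ_{q_S}(S↔b) = 1`),
`S ∩ A ≠ ∅` (KN Lemma 5 for an arbitrary relay, block form: the landed `stub_gluingLemma5` at `w⁰`),
`S` low (hypothesis).  Hence `μ_w(a₀↔b) ≤ μ_w(o↔b) + Σ_W μ_w(C(o)=W) c_W`, i.e. goodness.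

So the step is EXACTLY the glued corner inequality on the positive low layers: the singleton layers
follow from the induction hypothesis (`goodStep_corner_singleton`, file `…GoodStepCornerSingleton.lean`,
whence KN Theorem 5), and the layers with `|S| ≥ 2` are the open residue "GL" (= goodness with the
relay designated by the UNGLUED graph; evidence note `goodstep-k4-glued-corner.md` on the crux item:
GL ⟺ GOOD for the relay `argmin_{G−o}`, 0 violations in ≈ 10³ hill-climbed exact instances, refuted
strengthenings).
-/

namespace Summit.CriticalPhenomena.PercolationContinuityZ3.Theorems

open MeasureTheory Set
open Literature.Probability.LatticeModels (prodBernoulli)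
open Literature.Probability.Percolation (BondConfig openConn openConnIn openGraph openCluster
  openGraph_adj DeterminedBy determinedBy_iff)
open scoped BigOperators

noncomputable section
open Classical

variable {n : ℕ}

/-! ### The corner reduction -/

/-- **Corner reduction of the inductive step of "every quadruple is good"** (Kozma–Nitzan
arXiv:2401.12397 §3.2, proofs of Thms 4–5 pp. 13–14, with the dead-pocket penalty carried along
the layer decomposition).  Let `b ∈ A`, `o ∉ A`, `a₀ ∈ A` a minimiser over `A` of the
reliability OFF `o` (`μ_{w⁰}(· ↔ b)`), `sel` a selection of relays.  Suppose that for every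
nonempty positive LOW layer `S` (every `x ∈ S` has `x ≠ o`, `w(o,x) ≠ 0`; `S ∩ A = ∅`) the glued
corner inequality `μ_{q_S}(a₀ ↔ b) ≤ μ_{q_S}(S ↔ b) + Σ_{W ∋ o, W∩A=∅} μ_{q_S}(E_S W)·μ_w(sel W ↔ b in Wᶜ)`
holds.  Then `(w, A, o, b)` is good in the linear selection form: for every level `t` with
`1 − t ≤ μ_w(a ↔ b)` on `A`,
`μ_w(o ↔ A, o ↮ b) + Σ_W μ_w(C(o) = W)·μ_w((sel W ↔ b in Wᶜ)ᶜ) ≤ t`. -/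
theorem goodStep_corner (w : Sym2 (Fin n) → unitInterval) (A : Finset (Fin n)) (o b a₀ : Fin n)
    (sel : Finset (Fin n) → Fin n) (hbA : b ∈ A) (hoA : o ∉ A) (ha₀A : a₀ ∈ A)
    (hsel : ∀ W, sel W ∈ A)
    (hmin : ∀ v ∈ A,
      (prodBernoulli (fun e : Sym2 (Fin n) =>
          if (∃ x ∈ e, x ∈ ({o} : Finset (Fin n))) then (0 : unitInterval) else w e)).real
          (openConn a₀ b) ≤
        (prodBernoulli (fun e : Sym2 (Fin n) =>
          if (∃ x ∈ e, x ∈ ({o} : Finset (Fin n))) then (0 : unitInterval) else w e)).real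
          (openConn v b))
    (hcorner : ∀ S : Finset (Fin n), (∀ x ∈ S, x ≠ o ∧ w s(o, x) ≠ 0) → S.Nonempty →
      Disjoint S A →
      (prodBernoulli (fun e : Sym2 (Fin n) =>
          if (∀ x ∈ e, x ∈ S) ∧ ¬ e.IsDiag then (1 : unitInterval) else
            if (∃ x ∈ e, x ∈ ({o} : Finset (Fin n))) then 0 else w e)).real (openConn a₀ b) ≤
        (prodBernoulli (fun e : Sym2 (Fin n) =>
            if (∀ x ∈ e, x ∈ S) ∧ ¬ e.IsDiag then (1 : unitInterval) else
              if (∃ x ∈ e, x ∈ ({o} : Finset (Fin n))) then 0 else w e)).real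
            (⋃ s ∈ S, openConn s b) +
          ∑ W ∈ (Finset.univ : Finset (Finset (Fin n))).filter (fun W => o ∈ W ∧ Disjoint W A),
            (prodBernoulli (fun e : Sym2 (Fin n) =>
                if (∀ x ∈ e, x ∈ S) ∧ ¬ e.IsDiag then (1 : unitInterval) else
                  if (∃ x ∈ e, x ∈ ({o} : Finset (Fin n))) then 0 else w e)).real
                {ω' : BondConfig (Fin n) | ∀ y : Fin n, y ∈ W ↔ (y = o ∨ ∃ s ∈ S, ω' ∈ openConn s y)} *
              (prodBernoulli w).real (openConnIn ((W : Set (Fin n))ᶜ) (sel W) b))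
    (t : ℝ) (ht : ∀ a ∈ A, 1 - t ≤ (prodBernoulli w).real (openConn a b)) :
    (prodBernoulli w).real ((⋃ a ∈ A, openConn o a) ∩ (openConn o b)ᶜ)
      + ∑ W ∈ (Finset.univ : Finset (Finset (Fin n))).filter (fun W => o ∈ W ∧ Disjoint W A),
          (prodBernoulli w).real {ω : BondConfig (Fin n) | openCluster ω o = (W : Set (Fin n))}
            * (prodBernoulli w).real (openConnIn ((W : Set (Fin n))ᶜ) (sel W) b)ᶜ
      ≤ t := by
  set F : Finset (Finset (Fin n)) :=
    (Finset.univ : Finset (Finset (Fin n))).filter (fun W => o ∈ W ∧ Disjoint W A) with hF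
  set c : Finset (Fin n) → ℝ :=
    fun W => (prodBernoulli w).real (openConnIn ((W : Set (Fin n))ᶜ) (sel W) b) with hc
  have hbo : b ≠ o := fun h => hoA (h ▸ hbA)
  have ha₀o : a₀ ≠ o := fun h => hoA (h ▸ ha₀A)
  have hcompl : ∀ W : Finset (Fin n),
      (prodBernoulli w).real (openConnIn ((W : Set (Fin n))ᶜ) (sel W) b)ᶜ = 1 - c W := fun W =>
    probReal_compl_eq_one_sub MeasurableSet.of_discrete
  -- reduce to the KN form `μ(a₀ ↔ b) ≤ μ(o ↔ b) + Σ_W μ(C(o)=W) c_W`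
  suffices hKN : (prodBernoulli w).real (openConn a₀ b) ≤ (prodBernoulli w).real (openConn o b) +
      ∑ W ∈ F, (prodBernoulli w).real
        {ω : BondConfig (Fin n) | openCluster ω o = (W : Set (Fin n))} * c W by
    rw [Finset.sum_congr rfl fun W _ => by rw [hcompl W], goodStepCorner_selection_identity w A o b hbA c]
    have h := ht a₀ ha₀A
    linarith
  -- layer partitions
  have hpartA := sigmaRec_partition w ({o} : Finset (Fin n)) (openConn a₀ b)
  have hpartB := sigmaRec_partition w ({o} : Finset (Fin n)) (openConn o b)
  rw [Finset.sum_congr rfl fun S _ => goodStepCorner_fac_conn w o a₀ b S ha₀o hbo] at hpartA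
  rw [Finset.sum_congr rfl fun S _ => goodStepCorner_fac_obs w o b S hbo] at hpartB
  have hpock : ∑ W ∈ F, (prodBernoulli w).real
        {ω : BondConfig (Fin n) | openCluster ω o = (W : Set (Fin n))} * c W =
      ∑ S : Finset (Fin n), (prodBernoulli w).real
          {ω : BondConfig (Fin n) | ∀ x : Fin n, x ∈ S ↔
            (x ∉ ({o} : Finset (Fin n)) ∧ ∃ o' ∈ ({o} : Finset (Fin n)), s(o', x) ∈ ω)} *
        ∑ W ∈ F, (prodBernoulli (fun e : Sym2 (Fin n) =>
            if (∀ x ∈ e, x ∈ S) ∧ ¬ e.IsDiag then (1 : unitInterval) else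
              if (∃ x ∈ e, x ∈ ({o} : Finset (Fin n))) then 0 else w e)).real
            {ω' : BondConfig (Fin n) | ∀ y : Fin n, y ∈ W ↔ (y = o ∨ ∃ s ∈ S, ω' ∈ openConn s y)} *
          c W := by
    calc ∑ W ∈ F, (prodBernoulli w).real
            {ω : BondConfig (Fin n) | openCluster ω o = (W : Set (Fin n))} * c W
        = ∑ W ∈ F, ∑ S : Finset (Fin n), (prodBernoulli w).real
            {ω : BondConfig (Fin n) | ∀ x : Fin n, x ∈ S ↔
              (x ∉ ({o} : Finset (Fin n)) ∧ ∃ o' ∈ ({o} : Finset (Fin n)), s(o', x) ∈ ω)} *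
            ((prodBernoulli (fun e : Sym2 (Fin n) =>
              if (∀ x ∈ e, x ∈ S) ∧ ¬ e.IsDiag then (1 : unitInterval) else
                if (∃ x ∈ e, x ∈ ({o} : Finset (Fin n))) then 0 else w e)).real
              {ω' : BondConfig (Fin n) | ∀ y : Fin n, y ∈ W ↔ (y = o ∨ ∃ s ∈ S, ω' ∈ openConn s y)}
              * c W) := by
          refine Finset.sum_congr rfl fun W _ => ?_
          rw [sigmaRec_partition w ({o} : Finset (Fin n))
            {ω : BondConfig (Fin n) | openCluster ω o = (W : Set (Fin n))}, Finset.sum_mul]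
          refine Finset.sum_congr rfl fun S _ => ?_
          rw [goodStepCorner_fac_pocket w o S W, mul_assoc]
      _ = _ := by
          rw [Finset.sum_comm]
          refine Finset.sum_congr rfl fun S _ => ?_
          rw [Finset.mul_sum]
  rw [hpartA, hpartB, hpock, ← Finset.sum_add_distrib]
  refine Finset.sum_le_sum fun S _ => ?_
  rw [← mul_add]
  rcases eq_or_ne ((prodBernoulli w).real
      {ω : BondConfig (Fin n) | ∀ x : Fin n, x ∈ S ↔
        (x ∉ ({o} : Finset (Fin n)) ∧ ∃ o' ∈ ({o} : Finset (Fin n)), s(o', x) ∈ ω)}) 0 with h0 | h0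
  · rw [h0, zero_mul, zero_mul]
  refine mul_le_mul_of_nonneg_left ?_ measureReal_nonneg
  -- positive layers only
  have hpos := sigmaRec_posLayer w w ({o} : Finset (Fin n)) S (fun _ _ _ => rfl) h0
  have hS' : ∀ x ∈ S, x ≠ o ∧ w s(o, x) ≠ 0 := by
    intro x hx
    obtain ⟨hxO, o', ho', hw⟩ := hpos x hx
    rw [Finset.mem_singleton] at ho'
    subst ho'
    exact ⟨fun h => hxO (Finset.mem_singleton.2 h), hw⟩
  have hnn : 0 ≤ ∑ W ∈ F, (prodBernoulli (fun e : Sym2 (Fin n) =>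
        if (∀ x ∈ e, x ∈ S) ∧ ¬ e.IsDiag then (1 : unitInterval) else
          if (∃ x ∈ e, x ∈ ({o} : Finset (Fin n))) then 0 else w e)).real
        {ω' : BondConfig (Fin n) | ∀ y : Fin n, y ∈ W ↔ (y = o ∨ ∃ s ∈ S, ω' ∈ openConn s y)} *
      c W :=
    Finset.sum_nonneg fun W _ => mul_nonneg measureReal_nonneg measureReal_nonneg
  -- case `S = ∅`: the only pocket is `{o}`
  by_cases hSe : S = ∅
  · subst hSe
    have hq : (fun e : Sym2 (Fin n) =>
        if (∀ x ∈ e, x ∈ (∅ : Finset (Fin n))) ∧ ¬ e.IsDiag then (1 : unitInterval) else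
          if (∃ x ∈ e, x ∈ ({o} : Finset (Fin n))) then 0 else w e) =
        (fun e : Sym2 (Fin n) =>
          if (∃ x ∈ e, x ∈ ({o} : Finset (Fin n))) then (0 : unitInterval) else w e) :=
      goodStepCorner_glue_subsingleton _ ∅ (by simp)
    rw [hq]
    rw [hq] at hnn
    have hβ : (prodBernoulli (fun e : Sym2 (Fin n) =>
          if (∃ x ∈ e, x ∈ ({o} : Finset (Fin n))) then (0 : unitInterval) else w e)).real
        (⋃ s ∈ (∅ : Finset (Fin n)), (openConn s b : Set (BondConfig (Fin n)))) = 0 := by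
      simp
    have hmem : ({o} : Finset (Fin n)) ∈ F :=
      Finset.mem_filter.2 ⟨Finset.mem_univ _, Finset.mem_singleton_self o,
        Finset.disjoint_singleton_left.2 hoA⟩
    have hE : {ω' : BondConfig (Fin n) | ∀ y : Fin n, y ∈ ({o} : Finset (Fin n)) ↔
        (y = o ∨ ∃ s ∈ (∅ : Finset (Fin n)), ω' ∈ openConn s y)} = Set.univ := by
      refine Set.eq_univ_of_forall fun ω' y => ?_
      simp
    have hso : sel {o} ≠ o := fun h => hoA (h ▸ hsel {o})
    have hcW : c {o} = (prodBernoulli (fun e : Sym2 (Fin n) =>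
          if (∃ x ∈ e, x ∈ ({o} : Finset (Fin n))) then (0 : unitInterval) else w e)).real
        (openConn (sel {o}) b) := by
      simp only [hc]
      rw [Finset.coe_singleton, goodStepCorner_kill_real_openConn w o (sel {o}) b hso]
    have hterm : (prodBernoulli (fun e : Sym2 (Fin n) =>
          if (∃ x ∈ e, x ∈ ({o} : Finset (Fin n))) then (0 : unitInterval) else w e)).real
          {ω' : BondConfig (Fin n) | ∀ y : Fin n, y ∈ ({o} : Finset (Fin n)) ↔
            (y = o ∨ ∃ s ∈ (∅ : Finset (Fin n)), ω' ∈ openConn s y)} * c {o} ≤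
        ∑ W ∈ F, (prodBernoulli (fun e : Sym2 (Fin n) =>
          if (∃ x ∈ e, x ∈ ({o} : Finset (Fin n))) then (0 : unitInterval) else w e)).real
          {ω' : BondConfig (Fin n) | ∀ y : Fin n, y ∈ W ↔
            (y = o ∨ ∃ s ∈ (∅ : Finset (Fin n)), ω' ∈ openConn s y)} * c W :=
      Finset.single_le_sum (f := fun W => (prodBernoulli (fun e : Sym2 (Fin n) =>
          if (∃ x ∈ e, x ∈ ({o} : Finset (Fin n))) then (0 : unitInterval) else w e)).real
          {ω' : BondConfig (Fin n) | ∀ y : Fin n, y ∈ W ↔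
            (y = o ∨ ∃ s ∈ (∅ : Finset (Fin n)), ω' ∈ openConn s y)} * c W)
        (fun W _ => mul_nonneg measureReal_nonneg measureReal_nonneg) hmem
    rw [hβ, zero_add]
    calc (prodBernoulli (fun e : Sym2 (Fin n) =>
            if (∃ x ∈ e, x ∈ ({o} : Finset (Fin n))) then (0 : unitInterval) else w e)).real
            (openConn a₀ b)
        ≤ (prodBernoulli (fun e : Sym2 (Fin n) =>
            if (∃ x ∈ e, x ∈ ({o} : Finset (Fin n))) then (0 : unitInterval) else w e)).real
            (openConn (sel {o}) b) := hmin _ (hsel _)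
      _ = (prodBernoulli (fun e : Sym2 (Fin n) =>
            if (∃ x ∈ e, x ∈ ({o} : Finset (Fin n))) then (0 : unitInterval) else w e)).real
            {ω' : BondConfig (Fin n) | ∀ y : Fin n, y ∈ ({o} : Finset (Fin n)) ↔
              (y = o ∨ ∃ s ∈ (∅ : Finset (Fin n)), ω' ∈ openConn s y)} * c {o} := by
          rw [hE, probReal_univ, one_mul, hcW]
      _ ≤ _ := hterm
  have hoS : o ∉ S := fun h => (hS' o h).1 rfl
  -- case `b ∈ S`
  by_cases hbS : b ∈ S
  · have h1 : (prodBernoulli (fun e : Sym2 (Fin n) =>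
          if (∀ x ∈ e, x ∈ S) ∧ ¬ e.IsDiag then (1 : unitInterval) else
            if (∃ x ∈ e, x ∈ ({o} : Finset (Fin n))) then 0 else w e)).real
        (⋃ s ∈ S, (openConn s b : Set (BondConfig (Fin n)))) = 1 := by
      have huniv : (⋃ s ∈ S, (openConn s b : Set (BondConfig (Fin n)))) = Set.univ :=
        Set.eq_univ_of_forall fun ω =>
          Set.mem_iUnion₂.2 ⟨b, hbS, (SimpleGraph.Reachable.refl b : ω ∈ openConn b b)⟩
      rw [huniv, probReal_univ]
    have h2 : (prodBernoulli (fun e : Sym2 (Fin n) =>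
          if (∀ x ∈ e, x ∈ S) ∧ ¬ e.IsDiag then (1 : unitInterval) else
            if (∃ x ∈ e, x ∈ ({o} : Finset (Fin n))) then 0 else w e)).real
        (openConn a₀ b) ≤ 1 := measureReal_le_one
    linarith
  -- case `S ∩ A ≠ ∅`: Lemma 5
  by_cases hSA : (S ∩ A).Nonempty
  · obtain ⟨v, hv⟩ := hSA
    rw [Finset.mem_inter] at hv
    have h5 : (prodBernoulli (fun e : Sym2 (Fin n) =>
          if (∀ x ∈ e, x ∈ S) ∧ ¬ e.IsDiag then (1 : unitInterval) else
            if (∃ x ∈ e, x ∈ ({o} : Finset (Fin n))) then 0 else w e)).real (openConn a₀ b) ≤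
        (prodBernoulli (fun e : Sym2 (Fin n) =>
          if (∀ x ∈ e, x ∈ S) ∧ ¬ e.IsDiag then (1 : unitInterval) else
            if (∃ x ∈ e, x ∈ ({o} : Finset (Fin n))) then 0 else w e)).real
          (⋃ s ∈ S, openConn s b) :=
      stub_gluingLemma5 n _ S a₀ v b hv.1 hbS (hmin v hv.2)
    linarith
  -- low layer: the hypothesis
  · exact hcorner S hS' (Finset.nonempty_iff_ne_empty.2 hSe)
      (Finset.disjoint_iff_inter_eq_empty.2 (Finset.not_nonempty_iff_eq_empty.1 hSA))



/-- Registered helper stub `stub_goodStepCorner_k4` (siege k4, for `stub_goodStep`): **the corner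
reduction of the inductive step**, closed form of `goodStep_corner` — given `b ∈ A ∌ o`, a minimiser
`a₀` of `μ_{w⁰}(· ↔ b)` over `A`, a selection `sel W ∈ A`, and the glued corner inequality on every
nonempty positive low layer, the quadruple `(w, A, o, b)` is good at every admissible level.
[cite: KozmaNitzan2024, §3.2 (proofs of Thms 4–5, pp. 13–14)] -/
theorem stub_goodStepCorner_k4 :
    ∀ (n : ℕ) (w : Sym2 (Fin n) → unitInterval) (A : Finset (Fin n)) (o b a₀ : Fin n)
      (sel : Finset (Fin n) → Fin n), b ∈ A → o ∉ A → a₀ ∈ A → (∀ W, sel W ∈ A) →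
      (∀ v ∈ A,
        (prodBernoulli (fun e : Sym2 (Fin n) =>
            if (∃ x ∈ e, x ∈ ({o} : Finset (Fin n))) then (0 : unitInterval) else w e)).real
            (openConn a₀ b) ≤
          (prodBernoulli (fun e : Sym2 (Fin n) =>
            if (∃ x ∈ e, x ∈ ({o} : Finset (Fin n))) then (0 : unitInterval) else w e)).real
            (openConn v b)) →
      (∀ S : Finset (Fin n), (∀ x ∈ S, x ≠ o ∧ w s(o, x) ≠ 0) → S.Nonempty → Disjoint S A →
        (prodBernoulli (fun e : Sym2 (Fin n) =>
            if (∀ x ∈ e, x ∈ S) ∧ ¬ e.IsDiag then (1 : unitInterval) else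
              if (∃ x ∈ e, x ∈ ({o} : Finset (Fin n))) then 0 else w e)).real (openConn a₀ b) ≤
          (prodBernoulli (fun e : Sym2 (Fin n) =>
              if (∀ x ∈ e, x ∈ S) ∧ ¬ e.IsDiag then (1 : unitInterval) else
                if (∃ x ∈ e, x ∈ ({o} : Finset (Fin n))) then 0 else w e)).real
              (⋃ s ∈ S, openConn s b) +
            ∑ W ∈ (Finset.univ : Finset (Finset (Fin n))).filter (fun W => o ∈ W ∧ Disjoint W A),
              (prodBernoulli (fun e : Sym2 (Fin n) =>
                  if (∀ x ∈ e, x ∈ S) ∧ ¬ e.IsDiag then (1 : unitInterval) else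
                    if (∃ x ∈ e, x ∈ ({o} : Finset (Fin n))) then 0 else w e)).real
                  {ω' : BondConfig (Fin n) | ∀ y : Fin n, y ∈ W ↔ (y = o ∨ ∃ s ∈ S, ω' ∈ openConn s y)} *
                (prodBernoulli w).real (openConnIn ((W : Set (Fin n))ᶜ) (sel W) b)) →
      ∀ (t : ℝ), (∀ a ∈ A, 1 - t ≤ (prodBernoulli w).real (openConn a b)) →
        (prodBernoulli w).real ((⋃ a ∈ A, openConn o a) ∩ (openConn o b)ᶜ)
          + ∑ W ∈ (Finset.univ : Finset (Finset (Fin n))).filter (fun W => o ∈ W ∧ Disjoint W A),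
              (prodBernoulli w).real {ω : BondConfig (Fin n) | openCluster ω o = (W : Set (Fin n))}
                * (prodBernoulli w).real (openConnIn ((W : Set (Fin n))ᶜ) (sel W) b)ᶜ
          ≤ t :=
  fun _ w A o b a₀ sel hbA hoA ha₀A hsel hmin hcorner t ht =>
    goodStep_corner w A o b a₀ sel hbA hoA ha₀A hsel hmin hcorner t ht

end

end Summit.CriticalPhenomena.PercolationContinuityZ3.Theorems
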